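import Literature.Barriers.CriticalPhenomena.GridSAWTowersPieceFn
import Literature.Barriers.CriticalPhenomena.GridSAWTowersReduction
import Literature.Barriers.CriticalPhenomena.GridSAWDrawingChecker
import Literature.Barriers.CriticalPhenomena.GridSAWInstanceCanon
import Literature.Computability.Complexity.ListFoldBricks
import HarnessLib

/-!
# Tower step of Theorem 7 (1) (Liśkiewicz–Ogihara–Toda 2003), machine part (T3): the instance
# map `R₁ = towerCode` IS polynomial time — assembly of the machine and discharge of
# `LOT2003_thm7_fixedLength_towers`

Final file of the tower step. `GridSAWTowersReduction.lean` reduced the named sub-fact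
`LOT2003_thm7_fixedLength_towers : GRIDHAMPATHCOUNT ≤ᵖ_{parsimonious} SAWCOUNT₁` (Theorem 7 (1),
"Define `R₁(x) = (E₂, τ, h)`") to the machine fact `LOT2003_thm7_fixedLength_towers_FP :
towerCode ∈ FP`, `towerCode = encode ∘ towerInstance ∘ decode`. This file assembles a brick
function `TowerGen.towerCodeFn ∈ FP` and proves `towerCodeFn = towerCode`, from the four parts of
(T3) now in the tree:

* (A) `GridSAWInstanceCanon.lean` — `canonDrawnGraphFn w = encode (decDrawnGraph w)`, the total
  decoder `decode w = some (decDrawnGraph w)` (so every later stage sees a canonical code);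
* (B) `GridSAWDrawingChecker.lean` — the one-bit test `drawingChk ⟨code P, code D⟩ = [1] ↔
  IsGridDrawing P D`, and `lookupF ⟨code P, bin i⟩ = code P[i]`;
* (C) `GridSAWTowersEnumeration.lean` + `GridSAWTowersPieceFn.lean` — the generator
  `genItemsFn (ctx code Λ v) = framesOf (cV v) (drawnEdges (uniformize P D).2)`;
* (D) this file — on the canonical code `code P D s t = ⟨code P, ⟨code D, ⟨bin s, bin t⟩⟩⟩`:
  `lamFn` (**`1^Λ`, `Λ = maxEdges D`**, a max-fold `Brick.foldFn lamStep` over the edge codes,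
  `lamFn_code`; `foldl_max_eq_maxEdges`), the scaled end images `M P[s]`, `M P[t]` as difference
  pairs (`ms1F`, …, by `lookupF`, `ofSMFn`, `zmulF`), the context `ctxcF = ⟨code, ⟨1^Λ, -P₂[s]⟩⟩`,
  the header `hdrEcF = 1^{|D|·24Λ·Λ}` (`length_drawnEdges_uniformize`), `tauF` (the code of
  `P₂[t] - P₂[s]`), `lenF = bin (24Λ²(N-1))`, **`mainF`** with `mainF_code`: the code of
  `(E₂ - P₂[s], P₂[t] - P₂[s], 24Λ²(N-1))` (`encode_fixedLength_eq`, `encList_translate`,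
  `img_uniformize`); the branches `validF` (`drawingChk ∧ s < N ∧ t < N`, `validF_code`), `oneF`
  (`N ≤ 1`), `outF`, **`outF_code : outF (code P D s t) = encode (towerInstance P D s t)`**;
  `towerCodeFn = outF ∘ canonDrawnGraphFn`, **`towerCodeFn_mem_FP`**,
  **`towerCodeFn_eq_towerCode`**, **`LOT2003_thm7_fixedLength_towers_FP_holds`** and
  **`LOT2003_thm7_fixedLength_towers_holds`**.

No machine is written anywhere: every stage is an `FP` brick assembly whose value is computed
symbolically on the codes that matter and whose membership in `FP` is compositional.

## References

* M. Liśkiewicz, M. Ogihara, S. Toda, *The complexity of counting self-avoiding walks in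
  subgraphs of two-dimensional grids and hypercubes*, TCS 304 (2003) 129–156, §4, proof of
  Theorem 7 ("Define `R₁(x) = (E₂, τ, h)` … the pair `(R₁, R₃)` witnesses that the types 1–3 …
  are each `#P`-complete under `≤ᵖ_{r-shift}`-reductions"), §2.2 (polynomial-time reductions).
* S. Arora, B. Barak, *Computational Complexity: A Modern Approach*, CUP 2009, §1.3 (polynomial
  time: composition, bounded loops), §0.1 (codes).
-/

noncomputable section

namespace Literature.Barriers.CriticalPhenomena.GridSAW

open _root_.Computability Literature.Computability.Complexity Literature.Computability.Complexity.Brick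
  Polynomial

namespace TowerGen

/-! ### The canonical code and its fields -/

/-- The canonical presentation code. [folklore] -/
abbrev code (P : List GridPoint) (D : List DrawnEdge) (s t : ℕ) : List Bool :=
  encodingDrawnGraphInstance.encode (P, D, s, t)

/-- Field `code P`. [folklore] -/
def gPF : List Bool → List Bool := nthF 0
/-- Field `code D`. [folklore] -/
def gDF : List Bool → List Bool := nthF 1
/-- Field `bin s`. [folklore] -/
def gSF : List Bool → List Bool := nthF 2
/-- Field `bin t`. [folklore] -/
def gTF : List Bool → List Bool := sndPow 2
/-- `1^{|P|}`. [folklore] -/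
def hdrPF : List Bool → List Bool := fstF ∘ gPF
/-- `1^{|D|}`. [folklore] -/
def hdrD'F : List Bool → List Bool := fstF ∘ gDF
/-- The items of `D`. [folklore] -/
def itemsD'F : List Bool → List Bool := sndF ∘ gDF

section CodeFields
variable (P : List GridPoint) (D : List DrawnEdge) (s t : ℕ)
/-- Value of `gPF` on the canonical code of a presentation. [folklore] -/
theorem gPF_code : gPF (code P D s t) = encPL P := by rw [code, encDG_eq]; simp [gPF]
/-- Value of `gDF` on the canonical code of a presentation. [folklore] -/
theorem gDF_code : gDF (code P D s t) = boolPair (ones D.length) (encList (D.map encDE)) := by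
  rw [code, encDG_eq]; simp [gDF, nthF]
/-- Value of `gSF` on the canonical code of a presentation. [folklore] -/
theorem gSF_code : gSF (code P D s t) = encodeNat s := by rw [code, encDG_eq]; simp [gSF, nthF]
/-- Value of `gTF` on the canonical code of a presentation. [folklore] -/
theorem gTF_code : gTF (code P D s t) = encodeNat t := by rw [code, encDG_eq]; simp [gTF, sndPow]
/-- Value of `hdrPF` on the canonical code of a presentation. [folklore] -/
theorem hdrPF_code : hdrPF (code P D s t) = ones P.length := by
  rw [hdrPF, Function.comp_apply, gPF_code, encPL_eq, fstF_boolPair]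
/-- Value of `hdrD'F` on the canonical code of a presentation. [folklore] -/
theorem hdrD'F_code : hdrD'F (code P D s t) = ones D.length := by
  rw [hdrD'F, Function.comp_apply, gDF_code, fstF_boolPair]
/-- Value of `itemsD'F` on the canonical code of a presentation. [folklore] -/
theorem itemsD'F_code : itemsD'F (code P D s t) = encList (D.map encDE) := by
  rw [itemsD'F, Function.comp_apply, gDF_code, sndF_boolPair]
end CodeFields

/-- `gPF ∈ FP`. [folklore] -/
theorem gPF_mem_FP : gPF ∈ FP := nthF_mem_FP 0
/-- `gDF ∈ FP`. [folklore] -/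
theorem gDF_mem_FP : gDF ∈ FP := nthF_mem_FP 1
/-- `gSF ∈ FP`. [folklore] -/
theorem gSF_mem_FP : gSF ∈ FP := nthF_mem_FP 2
/-- `gTF ∈ FP`. [folklore] -/
theorem gTF_mem_FP : gTF ∈ FP := sndPow_mem_FP 2
/-- `hdrPF ∈ FP`. [folklore] -/
theorem hdrPF_mem_FP : hdrPF ∈ FP := comp_mem_FP fstF_mem_FP gPF_mem_FP
/-- `hdrD'F ∈ FP`. [folklore] -/
theorem hdrD'F_mem_FP : hdrD'F ∈ FP := comp_mem_FP fstF_mem_FP gDF_mem_FP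
/-- `itemsD'F ∈ FP`. [folklore] -/
theorem itemsD'F_mem_FP : itemsD'F ∈ FP := comp_mem_FP sndF_mem_FP gDF_mem_FP

/-! ### `Λ = maxEdges D` in unary, by a max-fold over the edge codes -/

/-- On the fold argument `⟨u, ⟨a, acc⟩⟩` with `a` the code of a drawn edge: `1^{|π_a| - 1}`
(the header of the path code, one symbol dropped). [folklore] -/
def candF : List Bool → List Bool :=
  Plumb.dropFn ∘ fanoutFn (fun _ => [true]) (fstF ∘ sndPow 1 ∘ fstF ∘ sndF)

/-- The step of the max-fold: the longer of the accumulator and the candidate. [folklore] -/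
def lamStep : List Bool → List Bool := iteFn (ltLenF ∘ fanoutFn (sndF ∘ sndF) candF) candF (sndF ∘ sndF)

/-- **`1^Λ`**: the max-fold over the items of `D`, started at `1¹`. [folklore] -/
def lamFn : List Bool → List Bool := foldFn lamStep (fun _ => [true]) ∘ fanoutFn (fun _ => []) itemsD'F

/-- `candF ∈ FP`. [folklore] -/
theorem candF_mem_FP : candF ∈ FP :=
  comp_mem_FP Plumb.dropFn_mem_FP (fanoutFn_mem_FP (const_mem_FP _)
    (comp_mem_FP fstF_mem_FP (comp_mem_FP (sndPow_mem_FP 1) (comp_mem_FP fstF_mem_FP sndF_mem_FP))))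
/-- `lamStep ∈ FP`. [folklore] -/
theorem lamStep_mem_FP : lamStep ∈ FP :=
  iteFn_mem_FP (comp_mem_FP ltLenF_mem_FP (fanoutFn_mem_FP (comp_mem_FP sndF_mem_FP sndF_mem_FP) candF_mem_FP))
    candF_mem_FP (comp_mem_FP sndF_mem_FP sndF_mem_FP)

/-- Size bound for `candF_le`. [folklore] -/
theorem length_candF_le (v : List Bool) : (candF v).length ≤ (fstF (sndF v)).length := by
  simp only [candF, Function.comp_apply, fanoutFn_apply, Plumb.dropFn_boolPair, List.length_drop,
    List.length_singleton, sndPow]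
  have h1 := length_fstF_sndF_le (fstF (sndF v))
  have h2 := length_fstF_sndF_le (sndF (fstF (sndF v)))
  have h3 := length_fstF_sndF_le (sndF (sndF (fstF (sndF v))))
  omega

/-- Size bound for `lamStep`. [folklore] -/
theorem foldGrowth_lamStep : FoldGrowth 0 lamStep := fun v => by
  rw [lamStep, iteFn_of_oneBit (oneBit_ltLenF.comp _)]
  have := length_candF_le v
  split_ifs
  · omega
  · simp only [Function.comp_apply]; omega

/-- `lamFn ∈ FP`. [folklore] -/
theorem lamFn_mem_FP : lamFn ∈ FP :=
  comp_mem_FP (foldFn_mem_FP lamStep_mem_FP (const_mem_FP _) foldGrowth_lamStep)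
    (fanoutFn_mem_FP (const_mem_FP _) itemsD'F_mem_FP)

/-- Value of `candF`. [folklore] -/
theorem candF_apply (u acc : List Bool) (d : DrawnEdge) :
    candF (boolPair u (boolPair (encDE d) acc)) = ones (d.2.2.length - 1) := by
  simp only [candF, Function.comp_apply, fanoutFn_apply, sndF_boolPair, fstF_boolPair, sndPow, encDE_eq, encPL_eq,
    show [true] = ones 1 from rfl, dropFn_boolPair_ones]

/-- Value of `lamStep`. [folklore] -/
theorem lamStep_apply (u : List Bool) (d : DrawnEdge) (n : ℕ) :
    lamStep (boolPair u (boolPair (encDE d) (ones n))) = ones (max n (d.2.2.length - 1)) := by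
  rw [lamStep, iteFn_of_oneBit (oneBit_ltLenF.comp _)]
  simp only [Function.comp_apply, fanoutFn_apply, sndF_boolPair, candF_apply, ltLenF_ones]
  by_cases h : n < d.2.2.length - 1
  · simp [h, max_eq_right h.le]
  · simp [h, max_eq_left (not_lt.mp h)]

/-- The max-fold from the left computes `maxEdges` (a fold from the right), from any start `≥ 1`.
[folklore] -/
theorem foldl_max_eq_maxEdges (D : List DrawnEdge) :
    ∀ n : ℕ, 1 ≤ n → D.foldl (fun m d => max m (d.2.2.length - 1)) n = max n (maxEdges D) := by
  induction D with
  | nil => intro n hn; simp [maxEdges, max_eq_left hn]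
  | cons d D ih =>
    intro n hn
    rw [List.foldl_cons, ih _ (le_trans hn (le_max_left _ _)),
      show maxEdges (d :: D) = max (d.2.2.length - 1) (maxEdges D) from rfl, max_assoc]

/-- **`lamFn (code) = 1^Λ`**, `Λ = maxEdges D`. [folklore] -/
theorem lamFn_code (P : List GridPoint) (D : List DrawnEdge) (s t : ℕ) : lamFn (code P D s t) = ones (maxEdges D) := by
  rw [lamFn, Function.comp_apply, fanoutFn_apply, itemsD'F_code, foldFn_apply]
  simp only [sndF_boolPair, decNil_encList]
  have key : ∀ (L : List DrawnEdge) (n : ℕ),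
      (L.map encDE).foldl (fun acc a => lamStep (boolPair (boolPair [] (encList (D.map encDE))) (boolPair a acc))) (ones n) =
        ones (L.foldl (fun m d => max m (d.2.2.length - 1)) n) := by
    intro L
    induction L with
    | nil => intro n; rfl
    | cons d L ih => intro n; rw [List.map_cons, List.foldl_cons, lamStep_apply, ih, List.foldl_cons]
  rw [show [true] = ones 1 from rfl, key, foldl_max_eq_maxEdges D 1 le_rfl, max_eq_right (one_le_maxEdges D)]


/-! ### The translation `-P₂[s]`, the context, the three fields, the main output -/

/-- The code of `P[s]` (`lookupF` of `GridSAWDrawingChecker.lean`: binary index against the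
header as ruler). [folklore] -/
def psF : List Bool → List Bool := lookupF ∘ fanoutFn gPF gSF
/-- The code of `P[t]`. [folklore] -/
def qtF : List Bool → List Bool := lookupF ∘ fanoutFn gPF gTF
/-- `1^M`, `M = 24Λ`. [folklore] -/
def uMcF : List Bool → List Bool := onesMulFn 24 ∘ lamFn
/-- `dpEnc (M · P[s].1)`. [folklore] -/
def ms1F : List Bool → List Bool := zmulF ∘ fanoutFn (natZF ∘ uMcF) (ofSMFn ∘ fstF ∘ psF)
/-- `dpEnc (M · P[s].2)`. [folklore] -/
def ms2F : List Bool → List Bool := zmulF ∘ fanoutFn (natZF ∘ uMcF) (ofSMFn ∘ sndF ∘ psF)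
/-- `dpEnc (M · P[t].1)`. [folklore] -/
def mt1F : List Bool → List Bool := zmulF ∘ fanoutFn (natZF ∘ uMcF) (ofSMFn ∘ fstF ∘ qtF)
/-- `dpEnc (M · P[t].2)`. [folklore] -/
def mt2F : List Bool → List Bool := zmulF ∘ fanoutFn (natZF ∘ uMcF) (ofSMFn ∘ sndF ∘ qtF)
/-- **The context of the generator** built from the canonical code: `⟨code, ⟨1^Λ, -P₂[s]⟩⟩`.
[folklore] -/
def ctxcF : List Bool → List Bool := fanoutFn (fun c => c) (fanoutFn lamFn (fanoutFn (znegF ∘ ms1F) (znegF ∘ ms2F)))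
/-- `1^{|E₂|} = 1^{|D| · 24Λ · Λ}`: the unary header of the edge-list code. [folklore] -/
def hdrEcF : List Bool → List Bool :=
  HashBricks.umulFn ∘ fanoutFn hdrD'F (HashBricks.umulFn ∘ fanoutFn uMcF lamFn)
/-- The code of the edge list `E₂ - P₂[s]`. [folklore] -/
def EcF : List Bool → List Bool := fanoutFn hdrEcF (genItemsFn ∘ ctxcF)
/-- The code of `τ = P₂[t] - P₂[s]`. [folklore] -/
def tauF : List Bool → List Bool :=
  fanoutFn (signMagOfZF ∘ zsubF ∘ fanoutFn mt1F ms1F) (signMagOfZF ∘ zsubF ∘ fanoutFn mt2F ms2F)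
/-- `bin (24Λ · Λ · (N - 1))`: the walk length. [folklore] -/
def lenF : List Bool → List Bool :=
  HashBricks.popCountFn ∘ HashBricks.umulFn ∘ fanoutFn (HashBricks.umulFn ∘ fanoutFn uMcF lamFn)
    (Plumb.dropFn ∘ fanoutFn (fun _ => [true]) hdrPF)
/-- **The main output**: the code of the instance `(E₂ - P₂[s], P₂[t] - P₂[s], 24Λ²(N-1))`.
[cite: LiskiewiczOgiharaToda2003, §4 (proof of Theorem 7: "Define R₁(x) = (E₂, τ, h)")] -/
def mainF : List Bool → List Bool := fanoutFn EcF (fanoutFn tauF lenF)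

/-- `psF ∈ FP`. [folklore] -/
theorem psF_mem_FP : psF ∈ FP := comp_mem_FP lookupF_mem_FP (fanoutFn_mem_FP gPF_mem_FP gSF_mem_FP)
/-- `qtF ∈ FP`. [folklore] -/
theorem qtF_mem_FP : qtF ∈ FP := comp_mem_FP lookupF_mem_FP (fanoutFn_mem_FP gPF_mem_FP gTF_mem_FP)
/-- `uMcF ∈ FP`. [folklore] -/
theorem uMcF_mem_FP : uMcF ∈ FP := comp_mem_FP (onesMulFn_mem_FP 24) lamFn_mem_FP
/-- `ms1F ∈ FP`. [folklore] -/
theorem ms1F_mem_FP : ms1F ∈ FP := comp_mem_FP zmulF_mem_FP (fanoutFn_mem_FP (comp_mem_FP natZF_mem_FP uMcF_mem_FP)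
  (comp_mem_FP ofSMFn_mem_FP (comp_mem_FP fstF_mem_FP psF_mem_FP)))
/-- `ms2F ∈ FP`. [folklore] -/
theorem ms2F_mem_FP : ms2F ∈ FP := comp_mem_FP zmulF_mem_FP (fanoutFn_mem_FP (comp_mem_FP natZF_mem_FP uMcF_mem_FP)
  (comp_mem_FP ofSMFn_mem_FP (comp_mem_FP sndF_mem_FP psF_mem_FP)))
/-- `mt1F ∈ FP`. [folklore] -/
theorem mt1F_mem_FP : mt1F ∈ FP := comp_mem_FP zmulF_mem_FP (fanoutFn_mem_FP (comp_mem_FP natZF_mem_FP uMcF_mem_FP)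
  (comp_mem_FP ofSMFn_mem_FP (comp_mem_FP fstF_mem_FP qtF_mem_FP)))
/-- `mt2F ∈ FP`. [folklore] -/
theorem mt2F_mem_FP : mt2F ∈ FP := comp_mem_FP zmulF_mem_FP (fanoutFn_mem_FP (comp_mem_FP natZF_mem_FP uMcF_mem_FP)
  (comp_mem_FP ofSMFn_mem_FP (comp_mem_FP sndF_mem_FP qtF_mem_FP)))
/-- `ctxcF ∈ FP`. [folklore] -/
theorem ctxcF_mem_FP : ctxcF ∈ FP := fanoutFn_mem_FP (PolyTimeComputable.id _) (fanoutFn_mem_FP lamFn_mem_FP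
  (fanoutFn_mem_FP (comp_mem_FP znegF_mem_FP ms1F_mem_FP) (comp_mem_FP znegF_mem_FP ms2F_mem_FP)))
/-- `hdrEcF ∈ FP`. [folklore] -/
theorem hdrEcF_mem_FP : hdrEcF ∈ FP := comp_mem_FP HashBricks.umulFn_mem_FP (fanoutFn_mem_FP hdrD'F_mem_FP
  (comp_mem_FP HashBricks.umulFn_mem_FP (fanoutFn_mem_FP uMcF_mem_FP lamFn_mem_FP)))
/-- `EcF ∈ FP`. [folklore] -/
theorem EcF_mem_FP : EcF ∈ FP := fanoutFn_mem_FP hdrEcF_mem_FP (comp_mem_FP genItemsFn_mem_FP ctxcF_mem_FP)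
/-- `tauF ∈ FP`. [folklore] -/
theorem tauF_mem_FP : tauF ∈ FP := fanoutFn_mem_FP
  (comp_mem_FP signMagOfZF_mem_FP (comp_mem_FP zsubF_mem_FP (fanoutFn_mem_FP mt1F_mem_FP ms1F_mem_FP)))
  (comp_mem_FP signMagOfZF_mem_FP (comp_mem_FP zsubF_mem_FP (fanoutFn_mem_FP mt2F_mem_FP ms2F_mem_FP)))
/-- `lenF ∈ FP`. [folklore] -/
theorem lenF_mem_FP : lenF ∈ FP := comp_mem_FP HashBricks.popCountFn_mem_FP (comp_mem_FP HashBricks.umulFn_mem_FP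
  (fanoutFn_mem_FP (comp_mem_FP HashBricks.umulFn_mem_FP (fanoutFn_mem_FP uMcF_mem_FP lamFn_mem_FP))
    (comp_mem_FP Plumb.dropFn_mem_FP (fanoutFn_mem_FP (const_mem_FP _) hdrPF_mem_FP))))
/-- **`mainF ∈ FP`.** [cite: AroraBarak2009, §1.3] -/
theorem mainF_mem_FP : mainF ∈ FP := fanoutFn_mem_FP EcF_mem_FP (fanoutFn_mem_FP tauF_mem_FP lenF_mem_FP)

/-! ### Values on the canonical code of a valid presentation -/

/-- The code of an edge list, flat. [folklore] -/
theorem encode_fixedLength_eq (E : EdgeList) (τ : GridPoint) (n : ℕ) :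
    encodingFixedLengthInstance.encode (E, τ, n) =
      boolPair (boolPair (ones E.length) (encList (E.map (encodingGridPoint.pairBool encodingGridPoint).encode)))
        (boolPair (encPt τ) (encodeNat n)) := by
  show boolPair (encodingEdgeList.encode E) _ = _
  rw [encodingEdgeList, listBool_encode_eq_encList, OracleCompose.unaryEncodeNat_eq_replicate]; rfl

/-- The items of the code of a translated edge list are the framed pieces. [folklore] -/
theorem encList_translate (v : GridPoint) (E : EdgeList) :
    encList ((translate v E).map (encodingGridPoint.pairBool encodingGridPoint).encode) = framesOf (cV v) E := by
  rw [framesOf, frames_eq_encList, translate, List.map_map]; rfl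

/-- Length of `pathEdges`. [folklore] -/
theorem length_pathEdges : ∀ l : List GridPoint, (pathEdges l).length = l.length - 1
  | [] => rfl
  | [_] => rfl
  | a :: b :: l => by rw [pathEdges_cons_cons, List.length_cons, length_pathEdges (b :: l)]; simp

/-- **The number of unit edges of `E₂`**: `|D| · 24Λ · Λ` (every new path has `24Λ² + 1` points).
[cite: LiskiewiczOgiharaToda2003, §4 (proof of Theorem 7: "e is realized by a path of length L²")] -/
theorem length_drawnEdges_uniformize {P : List GridPoint} {D : List DrawnEdge} (hD : IsGridDrawing P D) :
    (drawnEdges (uniformize P D).2).length = D.length * (24 * maxEdges D * maxEdges D) := by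
  rw [drawnEdges, List.length_flatMap]
  have hlen := length_uniformize hD
  have h : (uniformize P D).2.map (fun e => (pathEdges e.2.2).length) = (uniformize P D).2.map fun _ => 24 * maxEdges D * maxEdges D := by
    refine List.map_congr_left fun e he => ?_
    rw [length_pathEdges, hlen e he]; rfl
  rw [h, List.map_const', List.sum_replicate, smul_eq_mul]
  simp [uniformize]

section MainApply

variable {P : List GridPoint} {D : List DrawnEdge} (hD : IsGridDrawing P D) {s t : ℕ} (hs : s < P.length) (ht : t < P.length)

/-- Value of `psF` on the canonical code of a presentation. [folklore] -/
theorem psF_code (P : List GridPoint) (D : List DrawnEdge) {s : ℕ} (hs : s < P.length) (t : ℕ) :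
    psF (code P D s t) = encPt (P[s]) := by
  rw [psF, Function.comp_apply, fanoutFn_apply, gPF_code, gSF_code, encPL]; exact lookupF_apply P hs
/-- Value of `qtF` on the canonical code of a presentation. [folklore] -/
theorem qtF_code (P : List GridPoint) (D : List DrawnEdge) (s : ℕ) {t : ℕ} (ht : t < P.length) :
    qtF (code P D s t) = encPt (P[t]) := by
  rw [qtF, Function.comp_apply, fanoutFn_apply, gPF_code, gTF_code, encPL]; exact lookupF_apply P ht
/-- Value of `uMcF` on the canonical code of a presentation. [folklore] -/
theorem uMcF_code (P : List GridPoint) (D : List DrawnEdge) (s t : ℕ) : uMcF (code P D s t) = ones (bigM (maxEdges D)) := by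
  rw [uMcF, Function.comp_apply, lamFn_code, onesMulFn_ones]; rfl

include hs in
/-- Value of `ms1F` on the canonical code of a presentation. [folklore] -/
theorem ms1F_code : ms1F (code P D s t) = dpEnc ((bigM (maxEdges D) : ℤ) * (P[s]).1) := by
  simp only [ms1F, Function.comp_apply, fanoutFn_apply, uMcF_code, natZF_ones, psF_code P D hs t, encPt_eq,
    fstF_boolPair, ofSMFn_encInt, zmulF_boolPair, ival_dpEnc]
include hs in
/-- Value of `ms2F` on the canonical code of a presentation. [folklore] -/
theorem ms2F_code : ms2F (code P D s t) = dpEnc ((bigM (maxEdges D) : ℤ) * (P[s]).2) := by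
  simp only [ms2F, Function.comp_apply, fanoutFn_apply, uMcF_code, natZF_ones, psF_code P D hs t, encPt_eq,
    sndF_boolPair, ofSMFn_encInt, zmulF_boolPair, ival_dpEnc]
include ht in
/-- Value of `mt1F` on the canonical code of a presentation. [folklore] -/
theorem mt1F_code : mt1F (code P D s t) = dpEnc ((bigM (maxEdges D) : ℤ) * (P[t]).1) := by
  simp only [mt1F, Function.comp_apply, fanoutFn_apply, uMcF_code, natZF_ones, qtF_code P D s ht, encPt_eq,
    fstF_boolPair, ofSMFn_encInt, zmulF_boolPair, ival_dpEnc]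
include ht in
/-- Value of `mt2F` on the canonical code of a presentation. [folklore] -/
theorem mt2F_code : mt2F (code P D s t) = dpEnc ((bigM (maxEdges D) : ℤ) * (P[t]).2) := by
  simp only [mt2F, Function.comp_apply, fanoutFn_apply, uMcF_code, natZF_ones, qtF_code P D s ht, encPt_eq,
    sndF_boolPair, ofSMFn_encInt, zmulF_boolPair, ival_dpEnc]

/-- The translation vector `-P₂[s]`. [folklore] -/
def shiftVec (P : List GridPoint) (D : List DrawnEdge) (s : ℕ) (hs : s < P.length) : GridPoint :=
  (-((bigM (maxEdges D) : ℤ) * (P[s]).1), -((bigM (maxEdges D) : ℤ) * (P[s]).2))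

include hs in
/-- Value of `ctxcF` on the canonical code of a presentation. [folklore] -/
theorem ctxcF_code : ctxcF (code P D s t) = ctx (code P D s t) (maxEdges D) (shiftVec P D s hs) := by
  simp only [ctxcF, fanoutFn_apply, Function.comp_apply, lamFn_code, ms1F_code hs, ms2F_code hs, znegF_eq, ival_dpEnc,
    ctx, shiftVec]

/-- Value of `hdrEcF` on the canonical code of a presentation. [folklore] -/
theorem hdrEcF_code (P : List GridPoint) (D : List DrawnEdge) (s t : ℕ) :
    hdrEcF (code P D s t) = ones (D.length * (24 * maxEdges D * maxEdges D)) := by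
  simp only [hdrEcF, Function.comp_apply, fanoutFn_apply, hdrD'F_code, uMcF_code, lamFn_code, HashBricks.umulFn_boolPair, bigM]

/-- Value of `lenF` on the canonical code of a presentation. [folklore] -/
theorem lenF_code (P : List GridPoint) (D : List DrawnEdge) (s t : ℕ) :
    lenF (code P D s t) = encodeNat (24 * maxEdges D * maxEdges D * (P.length - 1)) := by
  simp only [lenF, Function.comp_apply, fanoutFn_apply, uMcF_code, lamFn_code, hdrPF_code, HashBricks.umulFn_boolPair,
    show [true] = ones 1 from rfl, dropFn_boolPair_ones, popCountFn_ones, bigM]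

include hs ht in
/-- Value of `tauF` on the canonical code of a presentation. [folklore] -/
theorem tauF_code : tauF (code P D s t) =
    encPt (((bigM (maxEdges D) : ℤ) * (P[t]).1 - (bigM (maxEdges D) : ℤ) * (P[s]).1,
      (bigM (maxEdges D) : ℤ) * (P[t]).2 - (bigM (maxEdges D) : ℤ) * (P[s]).2)) := by
  simp only [tauF, fanoutFn_apply, Function.comp_apply, mt1F_code ht, ms1F_code hs, mt2F_code ht, ms2F_code hs,
    zsubF_boolPair, ival_dpEnc, signMagOfZF_dpEnc', encPt_eq]

/-- The scaled vertex images: `(uniformize P D).1[i] = M • P[i]`. [folklore] -/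
theorem img_uniformize (P : List GridPoint) (D : List DrawnEdge) {i : ℕ} (hi : i < P.length) :
    img (uniformize P D).1 i = ((bigM (maxEdges D) : ℤ) * (P[i]).1, (bigM (maxEdges D) : ℤ) * (P[i]).2) := by
  have hi' : i < (uniformize P D).1.length := by simpa using hi
  rw [img_eq_getElem hi']
  simp only [uniformize, List.getElem_map]
  ext <;> simp

include hD hs ht in
/-- **The main output is the code of the main case of `towerInstance`.**
[cite: LiskiewiczOgiharaToda2003, §4 (proof of Theorem 7: "Define R₁(x) = (E₂, τ, h)")] -/
theorem mainF_code : mainF (code P D s t) =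
    encodingFixedLengthInstance.encode
      (translate (-(img (uniformize P D).1 s)) (drawnEdges (uniformize P D).2),
        img (uniformize P D).1 t - img (uniformize P D).1 s,
        24 * maxEdges D * maxEdges D * (P.length - 1)) := by
  rw [encode_fixedLength_eq, mainF, fanoutFn_apply, fanoutFn_apply, EcF, fanoutFn_apply, Function.comp_apply,
    hdrEcF_code, ctxcF_code hs, genItemsFn_ctx hD, tauF_code hs ht, lenF_code, img_uniformize P D hs,
    img_uniformize P D ht, encList_translate]
  congr 2
  rw [translate, List.length_map, length_drawnEdges_uniformize hD]

end MainApply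


/-! ### The branches: validity, the one-vertex graph; the instance map -/

/-- **The validity test** `[IsGridDrawing P D ∧ s < N ∧ t < N]` (the drawing checker of
`GridSAWDrawingChecker.lean`, and two binary comparisons against `bin N`). [cite: LiskiewiczOgiharaToda2003, §2.3 and §4 (the promise of #HamPath-Plan3 made checkable)] -/
def validF : List Bool → List Bool :=
  andFn (drawingChk ∘ fanoutFn gPF gDF)
    (andFn (ltFn ∘ fanoutFn gSF (lenBinF ∘ hdrPF)) (ltFn ∘ fanoutFn gTF (lenBinF ∘ hdrPF)))
/-- `[N ≤ 1]`. [folklore] -/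
def oneF : List Bool → List Bool := lenLeOneFn ∘ hdrPF
/-- The code of the one-walk instance. [folklore] -/
def code₁ : List Bool := encodingFixedLengthInstance.encode oneWalkInstance
/-- The code of the walk-free instance. [folklore] -/
def code₀ : List Bool := encodingFixedLengthInstance.encode noWalkInstance
/-- The instance map on canonical codes. [folklore] -/
def outF : List Bool → List Bool := iteFn validF (iteFn oneF (fun _ => code₁) mainF) fun _ => code₀
/-- **The instance map `R₁` as a brick assembly**: canonicalise (`GridSAWInstanceCanon.lean`),
then branch. [cite: LiskiewiczOgiharaToda2003, §4 (proof of Theorem 7: "Define R₁(x) = (E₂, τ, h)")] -/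
def towerCodeFn : List Bool → List Bool := outF ∘ canonDrawnGraphFn

/-- `validF ∈ FP`. [folklore] -/
theorem validF_mem_FP : validF ∈ FP :=
  andFn_mem_FP (comp_mem_FP drawingChk_mem_FP (fanoutFn_mem_FP gPF_mem_FP gDF_mem_FP))
    (andFn_mem_FP (comp_mem_FP ltFn_mem_FP (fanoutFn_mem_FP gSF_mem_FP (comp_mem_FP lenBinF_mem_FP hdrPF_mem_FP)))
      (comp_mem_FP ltFn_mem_FP (fanoutFn_mem_FP gTF_mem_FP (comp_mem_FP lenBinF_mem_FP hdrPF_mem_FP))))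
/-- `oneF ∈ FP`. [folklore] -/
theorem oneF_mem_FP : oneF ∈ FP := comp_mem_FP lenLeOneFn_mem_FP hdrPF_mem_FP
/-- `outF ∈ FP`. [folklore] -/
theorem outF_mem_FP : outF ∈ FP :=
  iteFn_mem_FP validF_mem_FP (iteFn_mem_FP oneF_mem_FP (const_mem_FP _) mainF_mem_FP) (const_mem_FP _)
/-- **`towerCodeFn ∈ FP`.** [cite: AroraBarak2009, §1.3 (closure of polynomial time under composition)] -/
theorem towerCodeFn_mem_FP : towerCodeFn ∈ FP := comp_mem_FP outF_mem_FP canonDrawnGraphFn_mem_FP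

/-- `validF` is one-bit. [folklore] -/
theorem oneBit_validF : OneBit validF :=
  oneBit_andFn (oneBit_drawingChk.comp _) (oneBit_andFn (oneBit_ltFn.comp _) (oneBit_ltFn.comp _))
/-- `oneF` is one-bit. [folklore] -/
theorem oneBit_oneF : OneBit oneF := oneBit_lenLeOneFn.comp _

/-- The field `code D` is the `listBool` code of `D`. [folklore] -/
theorem gDF_code' (P : List GridPoint) (D : List DrawnEdge) (s t : ℕ) :
    gDF (code P D s t) = encodingDrawnEdge.listBool.encode D := by
  rw [gDF_code, encode_drawnEdgeList_eq, OracleCompose.unaryEncodeNat_eq_replicate]; rfl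

/-- **Truth of the validity test.** [folklore] -/
theorem validF_code (P : List GridPoint) (D : List DrawnEdge) (s t : ℕ) :
    validF (code P D s t) = [decide (IsGridDrawing P D ∧ s < P.length ∧ t < P.length)] := by
  have h1 : (drawingChk ∘ fanoutFn gPF gDF) (code P D s t) = [decide (IsGridDrawing P D)] := by
    rw [Function.comp_apply, fanoutFn_apply, gPF_code, gDF_code', encPL]
    obtain ⟨b, hb⟩ := oneBit_drawingChk (drawingArg P D)
    have hiff := drawingChk_drawingArg_eq_true P D
    rw [drawingArg] at hb hiff
    rw [hb] at hiff ⊢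
    cases b
    · have : ¬ IsGridDrawing P D := fun h => by simpa using hiff.mpr h
      simp [this]
    · simp [hiff.mp rfl]
  have h2 : (ltFn ∘ fanoutFn gSF (lenBinF ∘ hdrPF)) (code P D s t) = [decide (s < P.length)] := by
    rw [Function.comp_apply, fanoutFn_apply, gSF_code, Function.comp_apply, hdrPF_code, lenBinF_apply, ltFn_boolPair]
    simp [ones]
  have h3 : (ltFn ∘ fanoutFn gTF (lenBinF ∘ hdrPF)) (code P D s t) = [decide (t < P.length)] := by
    rw [Function.comp_apply, fanoutFn_apply, gTF_code, Function.comp_apply, hdrPF_code, lenBinF_apply, ltFn_boolPair]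
    simp [ones]
  rw [validF, andFn_apply h1 (andFn_apply h2 h3)]
  congr 1
  rw [Bool.eq_iff_iff]; simp

/-- Truth of the one-vertex test. [folklore] -/
theorem oneF_code (P : List GridPoint) (D : List DrawnEdge) (s t : ℕ) :
    oneF (code P D s t) = [decide (P.length ≤ 1)] := by
  rw [oneF, Function.comp_apply, hdrPF_code]; simp [lenLeOneFn, ones]

/-- **The brick assembly computes `towerInstance` on canonical codes.**
[cite: LiskiewiczOgiharaToda2003, §4 (proof of Theorem 7)] -/
theorem outF_code (P : List GridPoint) (D : List DrawnEdge) (s t : ℕ) :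
    outF (code P D s t) = encodingFixedLengthInstance.encode (towerInstance P D s t) := by
  rw [outF, iteFn_of_oneBit oneBit_validF, validF_code]
  by_cases hv : IsGridDrawing P D ∧ s < P.length ∧ t < P.length
  · rw [if_pos (by simp [hv]), iteFn_of_oneBit oneBit_oneF, oneF_code]
    by_cases h1 : P.length ≤ 1
    · rw [if_pos (by simp [h1]), towerInstance_of_length_eq_one P D s t hv (by omega)]; rfl
    · rw [if_neg (by simp [h1]), towerInstance_of_ne_one P D s t hv (by omega), mainF_code hv.1 hv.2.1 hv.2.2]
  · rw [if_neg (by simp [hv]), towerInstance_of_not P D s t hv]; rfl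

/-- **The brick assembly IS `towerCode`** (both read the input through the total decoder).
[cite: LiskiewiczOgiharaToda2003, §4 (proof of Theorem 7: R₁)] -/
theorem towerCodeFn_eq_towerCode : towerCodeFn = towerCode := by
  funext w
  have hdec := decode_drawnGraph w
  rcases hi : decDrawnGraph w with ⟨P, D, s, t⟩
  rw [hi] at hdec
  rw [towerCodeFn, Function.comp_apply, hdec.2]
  simp only [towerCode, hdec.1]
  exact outF_code P D s t

/-- **Discharge of the machine half of the tower step**: `towerCode ∈ FP`.
[cite: LiskiewiczOgiharaToda2003, §2.2 and §4 (proof of Theorem 7: R₁ is polynomial time)] -/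
theorem LOT2003_thm7_fixedLength_towers_FP_holds : LOT2003_thm7_fixedLength_towers_FP := by
  show towerCode ∈ FP
  rw [← towerCodeFn_eq_towerCode]
  exact towerCodeFn_mem_FP

end TowerGen

/-- **The tower step of Theorem 7 (1) of Liśkiewicz–Ogihara–Toda 2003, DISCHARGED**:
`GRIDHAMPATHCOUNT ≤ᵖ_{parsimonious} SAWCOUNT₁` — the instance map `R₁ = towerCode` is in `FP`
(`TowerGen.LOT2003_thm7_fixedLength_towers_FP_holds`) and correct on every string
(`SAWCOUNT₁_towerCode`). [cite: LiskiewiczOgiharaToda2003, Theorem 7 (proof, types (1)–(3): "Define R₁(x) = (E₂, τ, h)")] -/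
theorem LOT2003_thm7_fixedLength_towers_holds : LOT2003_thm7_fixedLength_towers :=
  LOT2003_thm7_fixedLength_towers_of_FP TowerGen.LOT2003_thm7_fixedLength_towers_FP_holds


/-! ### Sanity checks -/

/-- On the one-edge presentation of the pivot file, the max-fold finds `Λ = 1`. [folklore] -/
theorem TowerGen.lamFn_oneEdge : TowerGen.lamFn (TowerGen.code oneEdgeDrawing.1 oneEdgeDrawing.2 0 1) = ones 1 := by
  rw [TowerGen.lamFn_code, maxEdges_oneEdge]

/-- Non-vacuity of the discharged reduction: the polynomial-time instance map sends the one-edge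
presentation (`N = 2`, one Hamiltonian `0`–`1` path) to an instance with exactly one walk.
[folklore] -/
theorem SAWCOUNT₁_towerCodeFn_oneEdge :
    SAWCOUNT₁ (TowerGen.towerCodeFn (encodingDrawnGraphInstance.encode (oneEdgeDrawing.1, oneEdgeDrawing.2, 0, 1))) = 1 := by
  rw [TowerGen.towerCodeFn_eq_towerCode, SAWCOUNT₁_towerCode,
    GRIDHAMPATHCOUNT_encode _ _ _ _ isGridDrawing_oneEdge (by decide) (by decide)]
  exact hamPathCount_oneEdge

/-- … and a non-drawing (a diagonal) to a walk-free instance. [folklore] -/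
theorem SAWCOUNT₁_towerCodeFn_diagonal :
    SAWCOUNT₁ (TowerGen.towerCodeFn (encodingDrawnGraphInstance.encode
      ([((0 : ℤ), (0 : ℤ)), (1, 1)], [(0, 1, [((0 : ℤ), (0 : ℤ)), (1, 1)])], 0, 1))) = 0 := by
  rw [TowerGen.towerCodeFn_eq_towerCode, SAWCOUNT₁_towerCode, GRIDHAMPATHCOUNT_encode_of_not _ _ _ _ not_isGridDrawing_diagonal]

end Literature.Barriers.CriticalPhenomena.GridSAW
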